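import Literature.NumberTheory.Automorphic.CMPrincipalSeriesTraceOrbitalForm        -- ★ (N-492S) S4: the a.e. weight of van Dijk vs canonical orbital integrals (`rootDeltaChar`, `distribHaarChar`, `HeisRing.skewModulus`)
import Summits.HodgeConjecture.HodgeConjecture.Theorems.F0P3cStCharTSTorusCompactPart -- ★ p849333 «TOR-DATA★» HAND 1: the compact part `M_c = 𝒪_vˣ × E¹_v` (term of record)
import Literature.NumberTheory.Rogawski1990.CMCharIdentityClauses                   -- ★ organ vocabulary (`Gqs`, `qsForm`)
import HarnessLib

/-!
# F0 · P3c · line LH6 «StCharTS» — THE TERMS OF RECORD OF THE (TOR) DISCHARGE ROAD (DEFS LEAF): torus chart, van Dijk weight, torus transform,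
# hyperbolic set, pair character  [Rogawski1990, §12.2 p. 173; §12.5 p. 182–183; §12.7 L. 12.7.2 (proof) p. 193 («`F_f(m) = Δ(m)Φ(m, f)`»); §4.9 (4.9.4) p. 56]

Cell `pub/hodgecm-mathlib`, crux H413 = `stmt-HodgeConjecture-24833` (`--supports` lane), route HCCMUnconditional; seat LH6-p01 (g2) = INTEGRATOR of the (TOR) road
(desk F0P3b-plan (g23) 05:28:37Z); census of record `F0/P3b/LH6-p01/g2/CENSUS-PSM.v2-TERMS.md` (1eb74f73e3a41ae8).  DEF LANE (precedent ★ `Theorems/F0P3bLocalAPacketsDefs`):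
five `def`s + their `rfl`-grade unfolding lemmas; NO instance, NO notation, NO `sorry`, NO named fact; nothing is asserted about `U(3)`.  Every brick of the road reads these
names: road (D) D3-ii (LH2-p03 (g3) ∕ LH7-p04 (g2)), «SHELL-FN★» (LH6-p05 (g2)), «WEYL-HYP★» (LH2-p01 (g3)), «PSM★» (this seat), and the later re-lettering of the (S-𝔇)
package conjunct (TOR) «∀ μM Haar, ∃ Ftr Ω toC, pin ∧ (WM) ∧ (HM) ∧ (PSM) ∧ (SHF′)» into «(WM) ∧ (HM) ∧ (SHF′) at `torusTransform`, `hyperbolicSet`, `pairChar`» once (PSM) is ★.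
CURRENCY: `G = Gqs L v` (≡ `↥(unitaryGroupOfForm (conjLocal L c v) (cmLocalForm L 3 v))`, `rfl`); `T = (cmBorelTriple L 3 v).M` the diagonal torus; the PARAMETER torus
`M = (LocalRing L v)ˣ × ↥(normOneUnits (conjLocal L c v))` of ★ p849140 ∕ p849227 ∕ p849458; `M_c` the ★ p849333 term; `mQv` the organ's CANONICAL orbital family.
* `torusChart L v : M → T`, `(α, z) ↦ d(α, z·σ(α)·α⁻¹, σ(α)⁻¹)` (§12.2 p. 173 `M ≅ E* × E¹`, `m = d(α, β, ᾱ⁻¹)`, `det m = z`); inverse = ★ `(torusEntry 0, torusDetNormOne)`.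
* `vanDijkWeight L v : T → ℂ`, print's `Δ(m) = |D_G(m)|` (p. 193) in the EXACT normalisation of ★ `smoothTrace_cmPrincipalSeries_map_symm_eq_inv_mul_integral`
  (`δ_B^{1∕2}(t) · ‖d₀⁻¹d₁ − 1‖ · χ⁻(d₀⁻¹d₂ − 1)`, `d i = torusEntry i t`), `0` off the regular set (a `μ_T`-null set, ★ `ae_isUnit_torusEntry_sub_three`).
* `torusTransform L v mQv μM φ : M → ℂ`, `m ↦ (2·μM(M_c))⁻¹ · Δ(ι m) · Φ^{can}(ι m, φ)` — van Dijk's `F_f` (p. 193) for the canonical orbital integrals of the organ, calibrated so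
  that «`Tr i_G(χ)(φ) = ∫_M F_φ χ̃ dμM + ∫_M F_φ (wχ)~ dμM`» ((PSM) of ★ p849458) holds for EVERY Haar `μM` (proof = «PSM★», separately).
* `hyperbolicSet L v : Set G`, the conjugates of the regular elements of `T` (§12.5 p. 182 `G^r`-part meeting `M`; LH2-p01's stage (A) object).
* `pairChar L v : (E_vˣ →* ℂˣ) × (E¹_v →* ℂˣ) → (M →* ℂˣ)`, `(χ₁, χ₂) ↦ χ₁ ∘ fst · χ₂ ∘ snd` (the `toC` of ★ p849140, pinned there by `toC χ m = χ₁ m₁ · χ₂ m₂`).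
HONEST LABEL: HC_CM is proved only modulo the 7 printed citations (2 remaining: hLiu418 = stmt-HodgeConjecture-24832, h413 = stmt-HodgeConjecture-24833) until rung 0 closes;
count-neutral (definitions only).

## References
* [Rogawski1990] J. D. Rogawski, *Automorphic Representations of Unitary Groups in Three Variables*, Ann. of Math. Stud. 123 (1990): §1.10 p. 9; §12.2 p. 173; §12.5 pp. 182–183;
  §12.7 L. 12.7.2 (proof) p. 193; §4.9 Lemma 4.9.2, (4.9.4) p. 56.
* [vanDijk1972] G. van Dijk, *Computation of certain induced characters of 𝔭-adic groups*, Math. Ann. 199 (1972), Thm. p. 237.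
-/

set_option autoImplicit false
-- the mandated namespace has the single-problem summit's repeated segment (`HodgeConjecture.HodgeConjecture`)
set_option linter.dupNamespace false

noncomputable section

open NumberField IsDedekindDomain MeasureTheory Topology
open scoped Matrix MatrixGroups NNReal
open Literature.NumberTheory.Rogawski1990 Literature.NumberTheory.Automorphic Literature.NumberTheory.Automorphic.UnitaryGroup
open Literature.MeasureTheory.Group

namespace Summit.HodgeConjecture.HodgeConjecture.Cruxes.H413.F0P3cStCharTSTorusDefs

variable (L : Type) [Field L] [NumberField L] [IsCMField L] (v : HeightOneSpectrum (𝓞 ↥(maximalRealSubfield L)))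

/-! ## §1 The torus chart `ι : E_vˣ × E¹_v → T`, `(α, z) ↦ d(α, z·σ(α)·α⁻¹, σ(α)⁻¹)` -/

/-- The diagonal entries of the chart: `(α, z·σ(α)·α⁻¹, σ(α)⁻¹)` (so that `det = z`). [cite: Rogawski1990, §12.2 p. 173] -/
def torusChartEntries (m : (LocalRing L v)ˣ × ↥(normOneUnits (conjLocal L (IsCMField.complexConj L) v))) : Fin 3 → (LocalRing L v)ˣ :=
  ![m.1,
    (m.2 : (LocalRing L v)ˣ) * Units.map ((conjLocal L (IsCMField.complexConj L) v : LocalRing L v →+* LocalRing L v) : LocalRing L v →* LocalRing L v) m.1 * m.1⁻¹,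
    (Units.map ((conjLocal L (IsCMField.complexConj L) v : LocalRing L v →+* LocalRing L v) : LocalRing L v →* LocalRing L v) m.1)⁻¹]

/-- `d(α, z·σ(α)·α⁻¹, σ(α)⁻¹) ∈ U(Φ₃)(L⁺_v)`: the three relations `σ(d_{2−i}) d_i = 1` of ★ `glDiagonal_mem_unitaryGroupOfForm_antidiagonal_iff` (`σ` is an involution,
`σ(z) z = 1`). [cite: Rogawski1990, §1.10 p. 9; §12.2 p. 173] -/
theorem glDiagonal_torusChartEntries_mem (m : (LocalRing L v)ˣ × ↥(normOneUnits (conjLocal L (IsCMField.complexConj L) v))) :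
    glDiagonal 3 (LocalRing L v) (torusChartEntries L v m) ∈ unitaryGroupOfForm (conjLocal L (IsCMField.complexConj L) v) (cmLocalForm L 3 v) := by
  rw [cmLocalForm_eq_over L 3 v, glDiagonal_mem_unitaryGroupOfForm_antidiagonal_iff]
  -- unit-level bookkeeping: `σ` on units, `σ ∘ σ = id`, `σ(z) z = 1`
  set σu : (LocalRing L v)ˣ →* (LocalRing L v)ˣ :=
    Units.map ((conjLocal L (IsCMField.complexConj L) v : LocalRing L v →+* LocalRing L v) : LocalRing L v →* LocalRing L v) with hσu
  have hcoe : ∀ u : (LocalRing L v)ˣ, conjLocal L (IsCMField.complexConj L) v (u : LocalRing L v) = ((σu u : (LocalRing L v)ˣ) : LocalRing L v) :=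
    fun u => by rw [hσu, Units.coe_map, MonoidHom.coe_coe]
  have hσσ : ∀ u : (LocalRing L v)ˣ, σu (σu u) = u := fun u => by
    apply Units.ext
    rw [hσu, Units.coe_map, Units.coe_map, MonoidHom.coe_coe, conjLocal_conjLocal_cm L v]
  have hz : σu (m.2 : (LocalRing L v)ˣ) * (m.2 : (LocalRing L v)ˣ) = 1 := by
    apply Units.ext
    rw [Units.val_mul, ← hcoe, Units.val_one]
    exact (mem_normOneUnits_iff _).1 m.2.2
  have h0 : torusChartEntries L v m 0 = m.1 := rfl
  have h1 : torusChartEntries L v m 1 = (m.2 : (LocalRing L v)ˣ) * σu m.1 * m.1⁻¹ := rfl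
  have h2 : torusChartEntries L v m 2 = (σu m.1)⁻¹ := rfl
  intro i
  fin_cases i
  · -- `i = 0`: `σ(d₂) d₀ = σ(σ(α)⁻¹) α = α⁻¹ α = 1`
    show conjLocal L (IsCMField.complexConj L) v ((torusChartEntries L v m (Fin.rev 0) : (LocalRing L v)ˣ) : LocalRing L v) *
      ((torusChartEntries L v m 0 : (LocalRing L v)ˣ) : LocalRing L v) = 1
    have hrev : (Fin.rev 0 : Fin 3) = 2 := by decide
    rw [hrev, h2, h0, hcoe, ← Units.val_mul, map_inv, hσσ, inv_mul_cancel, Units.val_one]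
  · -- `i = 1`: `σ(β) β = 1` for `β = z σ(α) α⁻¹`
    show conjLocal L (IsCMField.complexConj L) v ((torusChartEntries L v m (Fin.rev 1) : (LocalRing L v)ˣ) : LocalRing L v) *
      ((torusChartEntries L v m 1 : (LocalRing L v)ˣ) : LocalRing L v) = 1
    have hrev : (Fin.rev 1 : Fin 3) = 1 := by decide
    rw [hrev, h1, hcoe, ← Units.val_mul, map_mul, map_mul, map_inv, hσσ]
    have hre : σu (m.2 : (LocalRing L v)ˣ) * m.1 * (σu m.1)⁻¹ * ((m.2 : (LocalRing L v)ˣ) * σu m.1 * m.1⁻¹) =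
        (σu (m.2 : (LocalRing L v)ˣ) * (m.2 : (LocalRing L v)ˣ)) * ((σu m.1)⁻¹ * σu m.1) * (m.1 * m.1⁻¹) := by ac_rfl
    rw [hre, hz, inv_mul_cancel, mul_inv_cancel, one_mul, one_mul, Units.val_one]
  · -- `i = 2`: `σ(d₀) d₂ = σ(α) σ(α)⁻¹ = 1`
    show conjLocal L (IsCMField.complexConj L) v ((torusChartEntries L v m (Fin.rev 2) : (LocalRing L v)ˣ) : LocalRing L v) *
      ((torusChartEntries L v m 2 : (LocalRing L v)ˣ) : LocalRing L v) = 1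
    have hrev : (Fin.rev 2 : Fin 3) = 0 := by decide
    rw [hrev, h0, h2, hcoe, ← Units.val_mul, mul_inv_cancel, Units.val_one]

/-- **THE TORUS CHART `ι : M = E_vˣ × E¹_v → T`**, `(α, z) ↦ d(α, z·σ(α)·α⁻¹, σ(α)⁻¹)` — print's identification `M ≅ E* × E¹`, `m = d(α, β, ᾱ⁻¹)`, read with
`det m = z` so that `χ(ι(α, z)) = χ₁(α) χ₂(z)` for the pair characters of ★ `cmTorusCharPair`. [cite: Rogawski1990, §12.2 p. 173; §12.1 p. 171] -/
def torusChart (m : (LocalRing L v)ˣ × ↥(normOneUnits (conjLocal L (IsCMField.complexConj L) v))) : ↥(cmBorelTriple L 3 v).M :=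
  ⟨⟨glDiagonal 3 (LocalRing L v) (torusChartEntries L v m), glDiagonal_torusChartEntries_mem L v m⟩,
    (mem_torusU_iff _).2 ⟨torusChartEntries L v m, rfl⟩⟩

/-- Unfolding: the underlying invertible matrix of `ι m` is `diag(torusChartEntries m)`. [cite: Rogawski1990, §12.2 p. 173] -/
@[simp] theorem coe_torusChart (m : (LocalRing L v)ˣ × ↥(normOneUnits (conjLocal L (IsCMField.complexConj L) v))) :
    (((torusChart L v m : ↥(cmBorelTriple L 3 v).M) : ↥(unitaryGroupOfForm (conjLocal L (IsCMField.complexConj L) v) (cmLocalForm L 3 v))) :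
      GL (Fin 3) (LocalRing L v)) = glDiagonal 3 (LocalRing L v) (torusChartEntries L v m) := rfl

/-- The entries of `ι m` are `torusChartEntries m`: `torusEntry i (ι m) = (α, z σ(α) α⁻¹, σ(α)⁻¹)_i`. [cite: Rogawski1990, §12.2 p. 173] -/
theorem torusEntry_torusChart (m : (LocalRing L v)ˣ × ↥(normOneUnits (conjLocal L (IsCMField.complexConj L) v))) (i : Fin 3) :
    torusEntry (conjLocal L (IsCMField.complexConj L) v) (cmLocalForm L 3 v) i (torusChart L v m) = torusChartEntries L v m i :=
  torusEntry_eq_of_glDiagonal_eq _ _ i _ _ rfl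

/-- First coordinate: `torusEntry 0 (ι (α, z)) = α`. [cite: Rogawski1990, §12.2 p. 173] -/
@[simp] theorem torusEntry_zero_torusChart (m : (LocalRing L v)ˣ × ↥(normOneUnits (conjLocal L (IsCMField.complexConj L) v))) :
    torusEntry (conjLocal L (IsCMField.complexConj L) v) (cmLocalForm L 3 v) 0 (torusChart L v m) = m.1 := by
  rw [torusEntry_torusChart]; rfl

/-- The chart entries are MULTIPLICATIVE in `(α, z)` (everything commutes in `E_vˣ`). [cite: Rogawski1990, §12.2 p. 173] -/
theorem torusChartEntries_mul (m m' : (LocalRing L v)ˣ × ↥(normOneUnits (conjLocal L (IsCMField.complexConj L) v))) :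
    torusChartEntries L v (m * m') = torusChartEntries L v m * torusChartEntries L v m' := by
  funext i
  fin_cases i
  · rfl
  · show ((m * m').2 : (LocalRing L v)ˣ) * Units.map ((conjLocal L (IsCMField.complexConj L) v : LocalRing L v →+* LocalRing L v) :
        LocalRing L v →* LocalRing L v) (m * m').1 * (m * m').1⁻¹ =
      ((m.2 : (LocalRing L v)ˣ) * Units.map ((conjLocal L (IsCMField.complexConj L) v : LocalRing L v →+* LocalRing L v) :
        LocalRing L v →* LocalRing L v) m.1 * m.1⁻¹) *
      ((m'.2 : (LocalRing L v)ˣ) * Units.map ((conjLocal L (IsCMField.complexConj L) v : LocalRing L v →+* LocalRing L v) :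
        LocalRing L v →* LocalRing L v) m'.1 * m'.1⁻¹)
    rw [Prod.snd_mul, Prod.fst_mul, Subgroup.coe_mul, map_mul, mul_inv]
    ac_rfl
  · show (Units.map ((conjLocal L (IsCMField.complexConj L) v : LocalRing L v →+* LocalRing L v) : LocalRing L v →* LocalRing L v) (m * m').1)⁻¹ =
      (Units.map ((conjLocal L (IsCMField.complexConj L) v : LocalRing L v →+* LocalRing L v) : LocalRing L v →* LocalRing L v) m.1)⁻¹ *
      (Units.map ((conjLocal L (IsCMField.complexConj L) v : LocalRing L v →+* LocalRing L v) : LocalRing L v →* LocalRing L v) m'.1)⁻¹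
    rw [Prod.fst_mul, map_mul, mul_inv]

/-- At `1` the chart entries are `1`. [cite: Rogawski1990, §12.2 p. 173] -/
theorem torusChartEntries_one : torusChartEntries L v 1 = 1 := by
  funext i
  fin_cases i
  · rfl
  · show ((1 : (LocalRing L v)ˣ × ↥(normOneUnits (conjLocal L (IsCMField.complexConj L) v))).2 : (LocalRing L v)ˣ) *
        Units.map ((conjLocal L (IsCMField.complexConj L) v : LocalRing L v →+* LocalRing L v) : LocalRing L v →* LocalRing L v)
          (1 : (LocalRing L v)ˣ × ↥(normOneUnits (conjLocal L (IsCMField.complexConj L) v))).1 *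
        ((1 : (LocalRing L v)ˣ × ↥(normOneUnits (conjLocal L (IsCMField.complexConj L) v))).1)⁻¹ = 1
    rw [Prod.snd_one, Prod.fst_one, Subgroup.coe_one, map_one, inv_one, mul_one, mul_one]
  · show (Units.map ((conjLocal L (IsCMField.complexConj L) v : LocalRing L v →+* LocalRing L v) : LocalRing L v →* LocalRing L v)
        (1 : (LocalRing L v)ˣ × ↥(normOneUnits (conjLocal L (IsCMField.complexConj L) v))).1)⁻¹ = 1
    rw [Prod.fst_one, map_one, inv_one]

/-- **The chart is a group homomorphism `M →* T`** (hom form of `torusChart`, same function). [cite: Rogawski1990, §12.2 p. 173] -/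
def torusChartHom : ((LocalRing L v)ˣ × ↥(normOneUnits (conjLocal L (IsCMField.complexConj L) v))) →* ↥(cmBorelTriple L 3 v).M where
  toFun := torusChart L v
  map_one' := by
    apply Subtype.ext; apply Subtype.ext
    show glDiagonal 3 (LocalRing L v) (torusChartEntries L v 1) = 1
    rw [torusChartEntries_one, map_one]
  map_mul' m m' := by
    apply Subtype.ext; apply Subtype.ext
    show glDiagonal 3 (LocalRing L v) (torusChartEntries L v (m * m')) =
      glDiagonal 3 (LocalRing L v) (torusChartEntries L v m) * glDiagonal 3 (LocalRing L v) (torusChartEntries L v m')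
    rw [torusChartEntries_mul, map_mul]

/-- `torusChartHom` IS `torusChart` (`rfl`). [cite: Rogawski1990, §12.2 p. 173] -/
@[simp] theorem torusChartHom_apply (m : (LocalRing L v)ˣ × ↥(normOneUnits (conjLocal L (IsCMField.complexConj L) v))) :
    torusChartHom L v m = torusChart L v m := rfl

/-- **W-compatibility**: the chart of the reflected parameter `ω(α, z) = (σ(α)⁻¹, z)` has the entries of `ι(α, z)` in REVERSED order — `d(σ(α)⁻¹, β, α)` with the
SAME middle entry `β = z σ(α) α⁻¹` (print's Weyl reflection `d(α, β, ᾱ⁻¹) ↦ d(ᾱ⁻¹, β, α)`). [cite: Rogawski1990, §12.2 p. 173; §12.7 L. 12.7.2 (proof) p. 193] -/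
theorem torusChartEntries_reflect (m : (LocalRing L v)ˣ × ↥(normOneUnits (conjLocal L (IsCMField.complexConj L) v))) (i : Fin 3) :
    torusChartEntries L v
        ((Units.map ((conjLocal L (IsCMField.complexConj L) v : LocalRing L v →+* LocalRing L v) : LocalRing L v →* LocalRing L v) m.1)⁻¹, m.2) i =
      torusChartEntries L v m (Fin.rev i) := by
  have hσσ : ∀ u : (LocalRing L v)ˣ,
      Units.map ((conjLocal L (IsCMField.complexConj L) v : LocalRing L v →+* LocalRing L v) : LocalRing L v →* LocalRing L v)
        (Units.map ((conjLocal L (IsCMField.complexConj L) v : LocalRing L v →+* LocalRing L v) : LocalRing L v →* LocalRing L v) u) = u :=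
    fun u => by
      apply Units.ext
      rw [Units.coe_map, Units.coe_map, MonoidHom.coe_coe, conjLocal_conjLocal_cm L v]
  fin_cases i
  · rfl
  · show (m.2 : (LocalRing L v)ˣ) *
        Units.map ((conjLocal L (IsCMField.complexConj L) v : LocalRing L v →+* LocalRing L v) : LocalRing L v →* LocalRing L v)
          (Units.map ((conjLocal L (IsCMField.complexConj L) v : LocalRing L v →+* LocalRing L v) : LocalRing L v →* LocalRing L v) m.1)⁻¹ *
        ((Units.map ((conjLocal L (IsCMField.complexConj L) v : LocalRing L v →+* LocalRing L v) : LocalRing L v →* LocalRing L v) m.1)⁻¹)⁻¹ =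
      (m.2 : (LocalRing L v)ˣ) * Units.map ((conjLocal L (IsCMField.complexConj L) v : LocalRing L v →+* LocalRing L v) : LocalRing L v →* LocalRing L v) m.1 * m.1⁻¹
    rw [map_inv, hσσ, inv_inv]
    ac_rfl
  · show (Units.map ((conjLocal L (IsCMField.complexConj L) v : LocalRing L v →+* LocalRing L v) : LocalRing L v →* LocalRing L v)
        (Units.map ((conjLocal L (IsCMField.complexConj L) v : LocalRing L v →+* LocalRing L v) : LocalRing L v →* LocalRing L v) m.1)⁻¹)⁻¹ = m.1
    rw [map_inv, hσσ, inv_inv]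

/-- `det ι(α, z) = z`: the torus determinant of the chart is the `E¹`-parameter. [cite: Rogawski1990, §12.1 p. 171; §12.2 p. 173] -/
theorem torusDet_torusChart (m : (LocalRing L v)ˣ × ↥(normOneUnits (conjLocal L (IsCMField.complexConj L) v))) :
    torusDet (conjLocal L (IsCMField.complexConj L) v) (cmLocalForm L 3 v) (torusChart L v m) = (m.2 : (LocalRing L v)ˣ) := by
  rw [torusDet_eq_of_glDiagonal_eq _ _ (torusChart L v m) (torusChartEntries L v m) rfl, Fin.prod_univ_three]
  show m.1 * ((m.2 : (LocalRing L v)ˣ) * Units.map ((conjLocal L (IsCMField.complexConj L) v : LocalRing L v →+* LocalRing L v) :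
      LocalRing L v →* LocalRing L v) m.1 * m.1⁻¹) *
      (Units.map ((conjLocal L (IsCMField.complexConj L) v : LocalRing L v →+* LocalRing L v) : LocalRing L v →* LocalRing L v) m.1)⁻¹ =
    (m.2 : (LocalRing L v)ˣ)
  have hre : m.1 * ((m.2 : (LocalRing L v)ˣ) * Units.map ((conjLocal L (IsCMField.complexConj L) v : LocalRing L v →+* LocalRing L v) :
      LocalRing L v →* LocalRing L v) m.1 * m.1⁻¹) *
      (Units.map ((conjLocal L (IsCMField.complexConj L) v : LocalRing L v →+* LocalRing L v) : LocalRing L v →* LocalRing L v) m.1)⁻¹ =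
    (m.2 : (LocalRing L v)ˣ) * (m.1 * m.1⁻¹) *
      (Units.map ((conjLocal L (IsCMField.complexConj L) v : LocalRing L v →+* LocalRing L v) : LocalRing L v →* LocalRing L v) m.1 *
        (Units.map ((conjLocal L (IsCMField.complexConj L) v : LocalRing L v →+* LocalRing L v) : LocalRing L v →* LocalRing L v) m.1)⁻¹) := by
    ac_rfl
  rw [hre, mul_inv_cancel, mul_inv_cancel, mul_one, mul_one]

/-- `torusDetNormOne (ι(α, z)) = z` in `E¹`. [cite: Rogawski1990, §12.1 p. 171] -/
theorem torusDetNormOne_torusChart (m : (LocalRing L v)ˣ × ↥(normOneUnits (conjLocal L (IsCMField.complexConj L) v))) :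
    torusDetNormOne (conjLocal L (IsCMField.complexConj L) v) (cmLocalForm L 3 v) (cmLocalForm_eq_over L 3 v) (torusChart L v m) = m.2 := by
  apply Subtype.ext
  rw [coe_torusDetNormOne, torusDet_torusChart]

/-- **THE PAIR CHARACTER READ THROUGH THE CHART**: `χ(ι(α, z)) = χ₁(α) · χ₂(z)` for the ★ `cmTorusCharPair` of the organ's principal series — the chart turns
the organ's torus characters into the product characters `toC`∕`pairChar` of ★ p849140. [cite: Rogawski1990, §12.1 p. 171; §12.2 p. 173] -/
theorem cmTorusCharPair_torusChart (χ₁ : (LocalRing L v)ˣ →* ℂˣ) (χ₂ : ↥(normOneUnits (conjLocal L (IsCMField.complexConj L) v)) →* ℂˣ)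
    (m : (LocalRing L v)ˣ × ↥(normOneUnits (conjLocal L (IsCMField.complexConj L) v))) :
    cmTorusCharPair L v χ₁ χ₂ (torusChart L v m) = χ₁ m.1 * χ₂ m.2 := by
  show torusCharPair (conjLocal L (IsCMField.complexConj L) v) (cmLocalForm L 3 v) (cmLocalForm_eq_over L 3 v) 0 χ₁ χ₂ (torusChart L v m) = _
  rw [torusCharPair_apply, torusEntry_zero_torusChart, torusDetNormOne_torusChart]

/-! ## §2 van Dijk's weight `Δ(t)` in the normalisation of ★ `CMPrincipalSeriesTraceOrbitalForm` -/

/-- `diag(torusEntry · t) = t` for `t` in the diagonal torus. [cite: Rogawski1990, §1.10 p. 9] -/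
theorem glDiagonal_torusEntry (t : ↥(cmBorelTriple L 3 v).M) :
    glDiagonal 3 (LocalRing L v) (fun i => torusEntry (conjLocal L (IsCMField.complexConj L) v) (cmLocalForm L 3 v) i t) =
      ((t : ↥(unitaryGroupOfForm (conjLocal L (IsCMField.complexConj L) v) (cmLocalForm L 3 v))) : GL (Fin 3) (LocalRing L v)) := by
  obtain ⟨d, hd⟩ := (mem_torusU_iff _).1 t.2
  have : (fun i => torusEntry (conjLocal L (IsCMField.complexConj L) v) (cmLocalForm L 3 v) i t) = d :=
    funext fun i => torusEntry_eq_of_glDiagonal_eq _ _ i t d hd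
  rw [this, hd]

open scoped Classical in
/-- **VAN DIJK'S WEIGHT `Δ(t)`** on the diagonal torus `T` of `U(Φ₃)(L⁺_v)`: for `t` REGULAR in the sense «`d₀⁻¹d₁ − 1` and `d₀⁻¹d₂ − 1` are units» (`d i = torusEntry i t`)
it is `δ_B^{1∕2}(t) · ‖d₀⁻¹d₁ − 1‖ · χ⁻(d₀⁻¹d₂ − 1)` — EXACTLY the `μ_T`-a.e. weight multiplying the canonical orbital integral in ★
`smoothTrace_cmPrincipalSeries_map_symm_eq_inv_mul_integral` (`= |det(1 − Ad t)|^{1∕2}`-type Weyl denominator `|D_G(t)|`, print's `Δ(m)` p. 193) — and `0` otherwise (the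
non-regular part of `T` is `μ_T`-null, ★ `ae_isUnit_torusEntry_sub_three`). [cite: Rogawski1990, §12.7 L. 12.7.2 (proof) p. 193; §4.9 (4.9.4) p. 56; §12.5 p. 182] -/
def vanDijkWeight (t : ↥(cmBorelTriple L 3 v).M) : ℂ :=
  haveI := locallyCompactSpace_cmBorelU L 3 v
  if h : IsUnit ((((torusEntry (conjLocal L (IsCMField.complexConj L) v) (cmLocalForm L 3 v) 0 t)⁻¹ *
        torusEntry (conjLocal L (IsCMField.complexConj L) v) (cmLocalForm L 3 v) 1 t : (LocalRing L v)ˣ) : LocalRing L v) - 1) ∧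
      IsUnit ((((torusEntry (conjLocal L (IsCMField.complexConj L) v) (cmLocalForm L 3 v) 0 t)⁻¹ *
        torusEntry (conjLocal L (IsCMField.complexConj L) v) (cmLocalForm L 3 v) 2 t : (LocalRing L v)ˣ) : LocalRing L v) - 1) then
    ((rootDeltaChar (cmBorelTriple L 3 v).P
        ⟨(t : ↥(unitaryGroupOfForm (conjLocal L (IsCMField.complexConj L) v) (cmLocalForm L 3 v))), (cmBorelTriple L 3 v).M_le t.2⟩ : ℂˣ) : ℂ) *
      (((letI : MeasurableSpace (LocalRing L v) := borel _; haveI : BorelSpace (LocalRing L v) := ⟨rfl⟩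
        haveI : SecondCountableTopology (LocalRing L v) := secondCountableTopology_localRing (E := L) v
        ((distribHaarChar (LocalRing L v) h.1.unit)⁻¹ *
          (HeisRing.skewModulus (conjLocal L (IsCMField.complexConj L) v) (continuous_conjLocal L (IsCMField.complexConj L) v) h.2.unit
            (HeisRing.map_unit_torusCentralScalar_sub_one (conjLocal L (IsCMField.complexConj L) v) (cmLocalForm_eq_over L 3 v) t
              (glDiagonal_torusEntry L v t) h.2))⁻¹ : ℝ≥0)) : ℝ) : ℂ)⁻¹
  else 0

/-! ## §3 The regular hyperbolic set, the pair characters, the torus transform -/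

/-- **THE REGULAR HYPERBOLIC SET `Ω ⊆ U(Φ₃)(L⁺_v)`**: the conjugates of the regular elements of the diagonal torus (print: the part of `G^r` meeting `M`, the support
of the test functions of the split-torus Fourier step). [cite: Rogawski1990, §12.5 p. 182; §12.7 L. 12.7.2 (proof) p. 193] -/
def hyperbolicSet : Set (Gqs L v) :=
  {g | ∃ t : ↥(cmBorelTriple L 3 v).M,
      IsRegularElt ((((t : ↥(unitaryGroupOfForm (conjLocal L (IsCMField.complexConj L) v) (cmLocalForm L 3 v))) : Gqs L v).val :
        GL (Fin 3) (LocalRing L v))) ∧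
      IsConj (((t : ↥(unitaryGroupOfForm (conjLocal L (IsCMField.complexConj L) v) (cmLocalForm L 3 v))) : Gqs L v)) g}

/-- **THE PAIR CHARACTERS OF `M = E_vˣ × E¹_v`**: `(χ₁, χ₂) ↦ (m ↦ χ₁ m₁ · χ₂ m₂)` — the `toC` binder of ★ p849140 ∕ p849458, pinned there by this very formula.
[cite: Rogawski1990, §12.1 p. 171] -/
def pairChar (χ : ((LocalRing L v)ˣ →* ℂˣ) × (↥(normOneUnits (conjLocal L (IsCMField.complexConj L) v)) →* ℂˣ)) :
    ((LocalRing L v)ˣ × ↥(normOneUnits (conjLocal L (IsCMField.complexConj L) v))) →* ℂˣ :=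
  χ.1.comp (MonoidHom.fst _ _) * χ.2.comp (MonoidHom.snd _ _)

/-- The pin of ★ p849140: `pairChar χ m = χ₁ m₁ · χ₂ m₂`. [cite: Rogawski1990, §12.1 p. 171] -/
@[simp] theorem pairChar_apply (χ : ((LocalRing L v)ˣ →* ℂˣ) × (↥(normOneUnits (conjLocal L (IsCMField.complexConj L) v)) →* ℂˣ))
    (m : (LocalRing L v)ˣ × ↥(normOneUnits (conjLocal L (IsCMField.complexConj L) v))) : pairChar L v χ m = χ.1 m.1 * χ.2 m.2 := rfl

/-- `cmTorusCharPair χ₁ χ₂ ∘ ι = pairChar (χ₁, χ₂)`. [cite: Rogawski1990, §12.1 p. 171] -/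
theorem cmTorusCharPair_comp_torusChartHom (χ : ((LocalRing L v)ˣ →* ℂˣ) × (↥(normOneUnits (conjLocal L (IsCMField.complexConj L) v)) →* ℂˣ)) :
    (cmTorusCharPair L v χ.1 χ.2).comp (torusChartHom L v) = pairChar L v χ := by
  ext m
  · rw [MonoidHom.comp_apply, torusChartHom_apply, cmTorusCharPair_torusChart, pairChar_apply]

/-- **THE TORUS TRANSFORM `F_φ` OF A TEST FUNCTION** (print p. 193 «`F_f(m) = Δ(m)Φ(m, f)`, where `Φ` is the orbital integral») for the organ's CANONICAL orbital family
`mQv` and a Haar measure `μM` on `M`: `F_φ(m) = (2 μM(M_c))⁻¹ · Δ(ι m) · Φ^{can}(ι m, φ)` — the calibration `(2 μM(M_c))⁻¹` makes van Dijk's formula read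
`Tr i_G(χ)(φ) = ∫_M F_φ χ̃ dμM + ∫_M F_φ (wχ)~ dμM` ((PSM) of ★ p849458) for every Haar `μM` («PSM★», proved separately). [cite: Rogawski1990, §12.7 L. 12.7.2 (proof) p. 193; §4.9 (4.9.4) p. 56] -/
def torusTransform [MeasurableSpace (Gqs L v)]
    [∀ γ : Gqs L v, MeasurableSpace (Gqs L v ⧸ Subgroup.centralizer ({γ} : Set (Gqs L v)))]
    (mQv : OrbitalMeasureFamily (Gqs L v))
    [MeasurableSpace ((LocalRing L v)ˣ × ↥(normOneUnits (conjLocal L (IsCMField.complexConj L) v)))]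
    (μM : Measure ((LocalRing L v)ˣ × ↥(normOneUnits (conjLocal L (IsCMField.complexConj L) v))))
    (φ : Gqs L v → ℂ) (m : (LocalRing L v)ˣ × ↥(normOneUnits (conjLocal L (IsCMField.complexConj L) v))) : ℂ :=
  let Mc : Set ((LocalRing L v)ˣ × ↥(normOneUnits (conjLocal L (IsCMField.complexConj L) v))) :=
    ((((Submonoid.pi Set.univ (fun w : PlacesOver L v => (w.1.adicCompletionIntegers L).toSubring.toSubmonoid)).units.prod
      (⊤ : Subgroup ↥(normOneUnits (conjLocal L (IsCMField.complexConj L) v)))) :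
        Subgroup ((LocalRing L v)ˣ × ↥(normOneUnits (conjLocal L (IsCMField.complexConj L) v)))) :
          Set ((LocalRing L v)ˣ × ↥(normOneUnits (conjLocal L (IsCMField.complexConj L) v))))
  (((2 * μM.real Mc)⁻¹ : ℝ) : ℂ) *
    (vanDijkWeight L v (torusChart L v m) *
      classOrbitalIntegral mQv φ
        (ConjClasses.mk (((torusChart L v m : ↥(cmBorelTriple L 3 v).M) :
          ↥(unitaryGroupOfForm (conjLocal L (IsCMField.complexConj L) v) (cmLocalForm L 3 v))) : Gqs L v)))

end Summit.HodgeConjecture.HodgeConjecture.Cruxes.H413.F0P3cStCharTSTorusDefs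

end
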